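import Literature.NumberTheory.EllipticCurves.JZeroTwoPowerTorsionKummer
import HarnessLib

/-!
# `fn`-stable subgroups of the `ℤ[fn]/2^M`-line `E[2^M]` are the sub-lines `E[2^M][2^i]` (uniseriality)

Topic `NumberTheory/EllipticCurves`; namespace `Literature.NumberTheory.EllipticCurves.JZero`. THEOREMS ONLY: **no
definition and no named fact** (D-0026). Sequel of `JZeroTwoPowerTorsionGaloisLine` / `JZeroTwoPowerTorsionKummer`:
for `n = 2^M` and an additive `fn` on `E[n]` with `fn² + fn + 1 = 0` (the CM operator `[ω]` of a `j = 0` curve; `2`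
is inert in `ℤ[ω]`, so `E[2^M] ≅ ℤ[ω]/2^M` is UNISERIAL), every `fn`-STABLE additive subgroup `H ≤ E[2^M]` is one of
the `M + 1` sub-lines `E[2^M][2^i]`, `0 ≤ i ≤ M`:

* ★ `exists_mem_iff_two_pow_zsmul_eq_zero_of_fn_stable` — `∃ i ≤ M, ∀ Q, Q ∈ H ↔ 2^i • Q = 0`.

Proof: take `i` maximal with an element `P ∈ H` of exact order `2^i`; `H ⊆ E[2^M][2^i]` by maximality, and
`E[2^M][2^i] = ℤP + ℤ fn P ⊆ H` by the line structure (`exists_eq_zsmul_add_zsmul_fn_of_two_pow`) and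
`fn`-stability.  USE (Kolyvagin's descent at `p = 2` for `j = 0` curves, the local step at an inert Kolyvagin
prime `λ`): the `2`-primary torsion of the LOCAL points `E(K_λ)[2^∞] ⊆ E[2^N]` is `[ω]`-stable (`ω ∈ K`), hence
equals some `E[2^j]` EXACTLY, which gives the local Kummer parametrisation `E[2^{2κ}] ↠ E(K_λ)/2^{2κ}`,
`Z ↦ δ(u)` (`2^{j-2κ} u = Z`), of `CasselsTateLocalTermLine`.

References: [Rubin1999] K. Rubin, *Elliptic curves with complex multiplication and the conjecture of Birch and
Swinnerton-Dyer*, LNM 1716 (1999), Cor. 5.5 (`E[𝔞] ≅ 𝒪/𝔞`); [SilvermanAEC2009] J. H. Silverman, *AEC*, 2nd ed.,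
Cor. III.6.4(b).
-/

noncomputable section

open scoped Classical

universe u

namespace Literature.NumberTheory.EllipticCurves.JZero

open _root_.WeierstrassCurve

variable {K : Type u} [Field K] [CharZero K] (W : WeierstrassCurve K) [W.IsElliptic] (n : ℕ) [NeZero n] {M : ℕ}

omit [NeZero n] in
/-- ★ **`fn`-stable subgroups of `E[2^M]` are the `E[2^M][2^i]`** (`E[2^M] ≅ ℤ[fn]/2^M` is uniserial: `2` is
inert in `ℤ[fn] ≅ ℤ[ω]`). [cite: Rubin1999, Cor. 5.5] [cite: SilvermanAEC2009, Cor. III.6.4(b)] -/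
theorem exists_mem_iff_two_pow_zsmul_eq_zero_of_fn_stable
    (fn : geomTorsion W (n : ℤ) →+ geomTorsion W (n : ℤ)) (hn : n = 2 ^ M)
    (hrel : ∀ Q, fn (fn Q) + fn Q + Q = 0) (H : AddSubgroup (geomTorsion W (n : ℤ)))
    (hH : ∀ Q ∈ H, fn Q ∈ H) :
    ∃ i ≤ M, ∀ Q : geomTorsion W (n : ℤ), Q ∈ H ↔ ((2 : ℤ) ^ i) • Q = 0 := by
  have hkill := two_pow_zsmul_geomTorsion W n hn
  -- the exponent of `Q`: the least `k` with `2^k • Q = 0`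
  have hex : ∀ Q : geomTorsion W (n : ℤ), ∃ k : ℕ, ((2 : ℤ) ^ k) • Q = 0 := fun Q ↦ ⟨M, hkill Q⟩
  let ex : geomTorsion W (n : ℤ) → ℕ := fun Q ↦ Nat.find (hex Q)
  have hex_spec : ∀ Q, ((2 : ℤ) ^ ex Q) • Q = 0 := fun Q ↦ Nat.find_spec (hex Q)
  have hex_le : ∀ Q, ex Q ≤ M := fun Q ↦ Nat.find_le (hkill Q)
  have hex_min : ∀ Q {k : ℕ}, ((2 : ℤ) ^ k) • Q = 0 → ex Q ≤ k := fun Q k hk ↦ Nat.find_le hk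
  -- `i` := the largest exponent occurring in `H` (exists: exponents are `≤ M`, and `0 ∈ H`)
  have hbdd : ∃ i, (∃ P ∈ H, ex P = i) ∧ ∀ Q ∈ H, ex Q ≤ i := by
    classical
    refine ⟨Nat.findGreatest (fun i ↦ ∃ P ∈ H, ex P = i) M,
      Nat.findGreatest_spec (P := fun i ↦ ∃ P ∈ H, ex P = i) (hex_le 0) ⟨0, H.zero_mem, rfl⟩,
      fun Q hQ ↦ Nat.le_findGreatest (P := fun i ↦ ∃ P ∈ H, ex P = i) (hex_le Q) ⟨Q, hQ, rfl⟩⟩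
  obtain ⟨i, ⟨P, hP, hPi⟩, hmax⟩ := hbdd
  refine ⟨i, hPi ▸ hex_le P, fun Q ↦ ⟨fun hQ ↦ ?_, fun hQ ↦ ?_⟩⟩
  · -- `Q ∈ H ⇒ ex Q ≤ i ⇒ 2^i • Q = 0`
    have h := hex_spec Q
    rw [show i = ex Q + (i - ex Q) by have := hmax Q hQ; omega, pow_add, mul_comm, mul_smul, h, smul_zero]
  · -- `2^i • Q = 0 ⇒ Q = a P + b fn P ∈ H`
    rcases Nat.eq_zero_or_pos i with hi0 | hi0
    · rw [hi0, pow_zero, one_smul] at hQ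
      rw [hQ]; exact H.zero_mem
    have hP' : ((2 : ℤ) ^ (i - 1)) • P ≠ 0 := fun h ↦ by
      have := hex_min P h; omega
    obtain ⟨a, b, hab⟩ := exists_eq_zsmul_add_zsmul_fn_of_two_pow W n fn hn hrel (hPi ▸ hex_le P)
      (hPi ▸ hex_spec P) hP' hQ
    rw [hab]
    exact H.add_mem (H.zsmul_mem hP a) (H.zsmul_mem (hH P hP) b)

omit [NeZero n] in
/-- The same with the sub-line named: an `fn`-stable `H ≤ E[2^M]` EQUALS `E[2^M][2^i]` for some `i ≤ M`.
[cite: Rubin1999, Cor. 5.5] -/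
theorem exists_eq_torsionBy_of_fn_stable
    (fn : geomTorsion W (n : ℤ) →+ geomTorsion W (n : ℤ)) (hn : n = 2 ^ M)
    (hrel : ∀ Q, fn (fn Q) + fn Q + Q = 0) (H : AddSubgroup (geomTorsion W (n : ℤ)))
    (hH : ∀ Q ∈ H, fn Q ∈ H) :
    ∃ i ≤ M, H = AddSubgroup.torsionBy (geomTorsion W (n : ℤ)) ((2 : ℤ) ^ i) := by
  obtain ⟨i, hiM, hi⟩ := exists_mem_iff_two_pow_zsmul_eq_zero_of_fn_stable W n fn hn hrel H hH
  refine ⟨i, hiM, AddSubgroup.ext fun Q ↦ ?_⟩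
  rw [hi Q]
  exact (Submodule.mem_torsionBy_iff ((2 : ℤ) ^ i) Q).symm

/-- **Multiplication by `2^(i-k)` maps `E[2^M][2^i]` ONTO `E[2^M][2^k]`** (`k ≤ i ≤ M`): the surjection behind the
local Kummer parametrisation `Z ↦ δ(u)`, `2^{i-k} u = Z` (every `Z` of the sub-line `E[2^M][2^k]` is `2^{i-k} u` for
some `u ∈ E[2^M][2^i]`). [cite: SilvermanAEC2009, Cor. III.6.4(b)] -/
theorem exists_two_pow_zsmul_eq_of_two_pow_zsmul_eq_zero
    (fn : geomTorsion W (n : ℤ) →+ geomTorsion W (n : ℤ)) (hn : n = 2 ^ M)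
    (hrel : ∀ Q, fn (fn Q) + fn Q + Q = 0) {i k : ℕ} (hki : k ≤ i) (hiM : i ≤ M)
    {Z : geomTorsion W (n : ℤ)} (hZ : ((2 : ℤ) ^ k) • Z = 0) :
    ∃ u : geomTorsion W (n : ℤ), ((2 : ℤ) ^ i) • u = 0 ∧ ((2 : ℤ) ^ (i - k)) • u = Z := by
  rcases Nat.eq_zero_or_pos k with hk0 | hk0
  · subst hk0
    rw [pow_zero, one_smul] at hZ
    exact ⟨0, smul_zero _, by rw [hZ, smul_zero]⟩
  -- an element `u₀` of exact order `2^i` (from one of exact order `2^M`, times `2^(M-i)`)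
  obtain ⟨P₀, hP₀⟩ := exists_two_pow_pred_zsmul_ne_zero W n hn (by omega)
  set u₀ : geomTorsion W (n : ℤ) := ((2 : ℤ) ^ (M - i)) • P₀ with hu₀
  have hu₀i : ((2 : ℤ) ^ i) • u₀ = 0 := by
    rw [hu₀, smul_smul, ← pow_add, show i + (M - i) = M by omega]; exact two_pow_zsmul_geomTorsion W n hn P₀
  have hu₀' : ((2 : ℤ) ^ (i - 1)) • u₀ ≠ 0 := by
    rw [hu₀, smul_smul, ← pow_add, show i - 1 + (M - i) = M - 1 by omega]; exact hP₀
  -- `v₀ := 2^(i-k) u₀` has exact order `2^k`, so `Z = a v₀ + b fn v₀ = 2^(i-k) (a u₀ + b fn u₀)`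
  set v₀ : geomTorsion W (n : ℤ) := ((2 : ℤ) ^ (i - k)) • u₀ with hv₀
  have hv₀k : ((2 : ℤ) ^ k) • v₀ = 0 := by
    rw [hv₀, smul_smul, ← pow_add, show k + (i - k) = i by omega]; exact hu₀i
  have hv₀' : ((2 : ℤ) ^ (k - 1)) • v₀ ≠ 0 := by
    rw [hv₀, smul_smul, ← pow_add, show k - 1 + (i - k) = i - 1 by omega]; exact hu₀'
  obtain ⟨a, b, hab⟩ := exists_eq_zsmul_add_zsmul_fn_of_two_pow W n fn hn hrel (by omega : k ≤ M) hv₀k hv₀' hZ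
  refine ⟨a • u₀ + b • fn u₀, ?_, ?_⟩
  · rw [smul_add, smul_comm _ a, smul_comm _ b, ← map_zsmul fn ((2 : ℤ) ^ i), hu₀i, map_zero, smul_zero,
      smul_zero, add_zero]
  · rw [hab, hv₀, smul_add, smul_comm _ a, smul_comm _ b, ← map_zsmul fn ((2 : ℤ) ^ (i - k))]

end Literature.NumberTheory.EllipticCurves.JZero

end
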